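import Literature.Probability.LatticeModels.LatticeGreenPoisson
import Literature.Probability.LatticeModels.LatticeGreenLineEnergy
import HarnessLib

/-!
# Line «sandwich_discharge» on crux `HistoryTailL` (stmt-QuantumFields-19936), stub `stub_sandwichSweepGapCapped` (S′), brick B5 on `ℤ³` —
# (Z-d) «THE MULTIPLIER BOUND», FILE 1∕2: BESSEL ON THE BRILLOUIN ZONE FOR A LATTICE MULTIPLIER KERNEL, and the multiplier of
# second differences of the free Green function, `|(e^{ip·u} − 1)(e^{ip·v} − 1)∕(2ε(p))|² ≤ 1` (`≤ 1∕4` for mixed directions)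

Cell `ym3-torus` (YM ladder rung R3 = continuum SU(2) Yang–Mills on the three-torus — a RUNG, NOT the Clay problem: not d = 4, not
infinite volume, not a mass gap); WIDTH COPY «width 15» of ym3-torus-p1, gen 6; `--supports stmt-QuantumFields-19936` (helper).  THEOREMS ONLY
(0 `def`, default heartbeats), in the `ℤ^d` letters of lit ✓`LatticeGreenFunction` ∕ ✓`LatticeGreenPoisson` ∕ ✓`LatticeGreenLineEnergy`
(`Site d = Fin d → ℤ`, the SAME type as `Zd d` of ✓`B4Eq19LatticeOperators`; `brillouin`, `dispersion`, `SRW.phase`). ANY `d`.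

WHY (w8-19936 g8's LOCATE-B5-Z3-COMMUTATOR 036a878b §5∕§6 (Z-d), 19936 evidence #47; px8 g6 ARCH-S′ 9acc8a14 §3 B5).  The sweep's quadratic cost
(B1′∕B6: `Σ(d a_R)² ≤ A₂·L^j`, `A₂` UNIVERSAL, chosen before `j`) is a finite-box sum of squares of SECOND DIFFERENCES of the Green potential
`G₀ ∗ ω` of the matched charge; a pointwise route loses `log²(L^j)`, so the one genuinely Fourier step of B5 is Bessel with a bounded multiplier.
THIS FILE is the kernel-independent half: for ANY real lattice kernel `K` with a Fourier representation `K(w) = (2π)^{−d}∫ Re(e^{ip·w} m(p)) dp`,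
integrable integrand and `|m|² ≤ C` on `[-π,π]^d`,
  ★★`sum_sq_conv_le_of_multiplier_bound`:  `∑_{x∈B} (∑_{y∈S} K(x−y) ω(y))² ≤ C · ∑_{y∈S} ω(y)²`  for EVERY finite `B ⊆ ℤ^d`
(§5; Bessel for the orthogonal family `{e^{ip·x}}_{x∈B}` against `m · conj ω̂` in the AM–GM form `Σc² = (2π)^{−d}∫Re(m ĉ conj ω̂) ≤ ½Σc² + ½CΣω²`),
resting on §1 characters `e^{ip·z}`, §2 ★`integral_norm_sq_trigPoly` (PARSEVAL `∫|∑_{x∈B} cₓe^{ip·x}|² = (2π)^d Σcₓ²`, orthogonality = lit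
✓`integral_brillouin_cos_sum_mul`), §4 ★`sum_mul_conv_eq_integral` (the kernel tested against a finite family is ONE Brillouin integral); and
§3 ★`norm_sq_multiplier_le_one` ∕ ★`norm_sq_multiplier_le_quarter`: for signed unit coordinate steps `u = ±e_a`, `v = ±e_b` the multiplier of
`∇_u∇_v G₀` (`G₀ = latticeGreen∕2`), `m(p) = (e^{ip·u} − 1)(e^{ip·v} − 1)∕(2ε(p))`, has `|m(p)|² = (1 − cos p_a)(1 − cos p_b)∕ε(p)² ≤ 1`, and `≤ 1∕4`
if `a ≠ b` (AM–GM, `(1 − cos p_a) + (1 − cos p_b) ≤ ε(p)`).  FILE 2∕2 `…GreenSecondDifferenceBessel` instantiates `K :=` the second difference of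
`G₀` and lands `Σ_B (∇_u∇_v(G₀ ∗ ω))² ≤ Σ ω²` (`≤ ¼Σω²`).  Text-independent of the stub and of bricks (Z-a)(Z-b)(Z-c)(Z-e); restates no stub text.
HONEST SCOPE: Fourier bookkeeping on `ℤ^d`; NOTHING here proves B5, the capped stub, `HistoryTailL`, or any summit statement; YM₃ on T³ is rung R3,
not Clay. [folklore] (Bessel ∕ Parseval on `𝕋^d`; cf. Lawler, *Intersections of Random Walks* (1991) §1.5–1.6).
-/

noncomputable section

open MeasureTheory Finset

namespace Summit.QuantumFields.YangMills.Theorems.CovariantDischargeBrillouinMultiplierBessel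

open Literature.Probability.LatticeModels

variable {d : ℕ}

/-! ## §1 Characters `e^{i p·z}` on the Brillouin zone -/

/-- `Re e^{iθ} = cos θ`. [folklore] -/
theorem re_cexp_I_mul (θ : ℝ) : (Complex.exp (Complex.I * θ)).re = Real.cos θ := by
  rw [mul_comm, Complex.exp_ofReal_mul_I_re]

/-- `Im e^{iθ} = sin θ`. [folklore] -/
theorem im_cexp_I_mul (θ : ℝ) : (Complex.exp (Complex.I * θ)).im = Real.sin θ := by
  rw [mul_comm, Complex.exp_ofReal_mul_I_im]

/-- `conj e^{iθ} = e^{-iθ}` for real `θ`. [folklore] -/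
theorem conj_cexp_I_mul (θ : ℝ) :
    (starRingEnd ℂ) (Complex.exp (Complex.I * θ)) = Complex.exp (-(Complex.I * θ)) := by
  rw [← Complex.exp_conj, map_mul, Complex.conj_I, Complex.conj_ofReal, neg_mul]

/-- `e^{i p·(x - y)} = e^{i p·x} · conj e^{i p·y}`. [folklore] -/
theorem cexp_phase_sub (p : Fin d → ℝ) (x y : Site d) :
    Complex.exp (Complex.I * (SRW.phase p (x - y) : ℝ)) =
      Complex.exp (Complex.I * (SRW.phase p x : ℝ)) *
        (starRingEnd ℂ) (Complex.exp (Complex.I * (SRW.phase p y : ℝ))) := by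
  rw [conj_cexp_I_mul, ← Complex.exp_add]
  congr 1
  have h : SRW.phase p (x - y) = SRW.phase p x - SRW.phase p y := by
    have := SRW.phase_add p (x - y) y
    rw [sub_add_cancel] at this
    linarith
  rw [h]; push_cast; ring

/-- `e^{i p·(x + y)} = e^{i p·x} · e^{i p·y}`. [folklore] -/
theorem cexp_phase_add (p : Fin d → ℝ) (x y : Site d) :
    Complex.exp (Complex.I * (SRW.phase p (x + y) : ℝ)) =
      Complex.exp (Complex.I * (SRW.phase p x : ℝ)) * Complex.exp (Complex.I * (SRW.phase p y : ℝ)) := by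
  rw [← Complex.exp_add, SRW.phase_add]; push_cast; ring_nf

/-! ## §2 Parseval for trigonometric polynomials on `[-π,π]^d` -/

/-- `|∑ₓ cₓ e^{i p·x}|² = ∑ₓ ∑_y cₓ c_y cos (p·x - p·y)` for real coefficients. [folklore] -/
theorem norm_sq_trigPoly_eq (B : Finset (Site d)) (c : Site d → ℝ) (p : Fin d → ℝ) :
    ‖∑ x ∈ B, (c x : ℂ) * Complex.exp (Complex.I * (SRW.phase p x : ℝ))‖ ^ 2 =
      ∑ x ∈ B, ∑ y ∈ B, c x * c y * Real.cos (SRW.phase p x - SRW.phase p y) := by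
  rw [sum_sum_mul_mul_cos_sub, Complex.sq_norm, Complex.normSq_apply]
  have hre : (∑ x ∈ B, (c x : ℂ) * Complex.exp (Complex.I * (SRW.phase p x : ℝ))).re =
      ∑ x ∈ B, c x * Real.cos (SRW.phase p x) := by
    rw [Complex.re_sum]
    refine Finset.sum_congr rfl fun x _ => ?_
    rw [Complex.re_ofReal_mul, re_cexp_I_mul]
  have him : (∑ x ∈ B, (c x : ℂ) * Complex.exp (Complex.I * (SRW.phase p x : ℝ))).im =
      ∑ x ∈ B, c x * Real.sin (SRW.phase p x) := by
    rw [Complex.im_sum]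
    refine Finset.sum_congr rfl fun x _ => ?_
    rw [Complex.im_ofReal_mul, im_cexp_I_mul]
  rw [hre, him]; ring

/-- Orthogonality in `phase` letters: `∫_{[-π,π]^d} cos (p·x - p·y) dp = (2π)^d [x = y]`. [folklore] -/
theorem integral_brillouin_cos_phase_sub (x y : Site d) :
    ∫ p in brillouin d, Real.cos (SRW.phase p x - SRW.phase p y) =
      if x = y then (2 * Real.pi) ^ d else 0 := by
  have h : ∀ p : Fin d → ℝ, SRW.phase p x - SRW.phase p y = ∑ j, p j * ((x - y) j : ℝ) := by
    intro p
    have := SRW.phase_add p (x - y) y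
    rw [sub_add_cancel] at this
    show _ = SRW.phase p (x - y)
    linarith
  simp_rw [h, integral_brillouin_cos_sum_mul (x - y), sub_eq_zero]

/-- **Parseval for a trigonometric polynomial with real coefficients on distinct lattice
frequencies**: `∫_{[-π,π]^d} |∑_{x∈B} cₓ e^{i p·x}|² dp = (2π)^d ∑_{x∈B} cₓ²`. [folklore] -/
theorem integral_norm_sq_trigPoly (B : Finset (Site d)) (c : Site d → ℝ) :
    ∫ p in brillouin d, ‖∑ x ∈ B, (c x : ℂ) * Complex.exp (Complex.I * (SRW.phase p x : ℝ))‖ ^ 2 =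
      (2 * Real.pi) ^ d * ∑ x ∈ B, c x ^ 2 := by
  simp_rw [norm_sq_trigPoly_eq]
  have hint : ∀ x ∈ B, ∀ y ∈ B, Integrable
      (fun p : Fin d → ℝ => c x * c y * Real.cos (SRW.phase p x - SRW.phase p y))
      (volume.restrict (brillouin d)) := by
    intro x _ y _
    have hc : Continuous fun p : Fin d → ℝ => c x * c y * Real.cos (SRW.phase p x - SRW.phase p y) := by
      unfold SRW.phase; fun_prop
    exact hc.continuousOn.integrableOn_compact (isCompact_brillouin d)
  rw [integral_finsetSum B fun x hx => integrable_finsetSum B fun y hy => hint x hx y hy]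
  have h1 : ∀ x ∈ B, ∫ p in brillouin d, ∑ y ∈ B, c x * c y * Real.cos (SRW.phase p x - SRW.phase p y) =
      (2 * Real.pi) ^ d * c x ^ 2 := by
    intro x hx
    rw [integral_finsetSum B fun y hy => hint x hx y hy]
    have h2 : ∀ y ∈ B, ∫ p in brillouin d, c x * c y * Real.cos (SRW.phase p x - SRW.phase p y) =
        c x * c y * (if x = y then (2 * Real.pi) ^ d else 0) := by
      intro y _
      rw [integral_const_mul, integral_brillouin_cos_phase_sub]
    rw [Finset.sum_congr rfl h2, Finset.sum_eq_single x (fun y _ hyx => by simp [Ne.symm hyx])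
      (fun h => absurd hx h)]
    simp; ring
  rw [Finset.sum_congr rfl h1, ← Finset.mul_sum]

/-! ## §3 The second-difference multiplier and its bound -/

/-- `|e^{iθ} - 1|² = 2 (1 - cos θ)`. [folklore] -/
theorem norm_sq_cexp_I_mul_sub_one (θ : ℝ) :
    ‖Complex.exp (Complex.I * θ) - 1‖ ^ 2 = 2 * (1 - Real.cos θ) := by
  rw [Complex.sq_norm, Complex.normSq_apply, Complex.sub_re, Complex.sub_im, re_cexp_I_mul,
    im_cexp_I_mul, Complex.one_re, Complex.one_im]
  nlinarith [Real.sin_sq_add_cos_sq θ]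

/-- The phase of a signed unit coordinate vector: `p·(±e_a) = ±p_a`, so `cos (p·u) = cos p_a`.
[folklore] -/
theorem cos_phase_unitStep (p : Fin d → ℝ) {a : Fin d} {u : Site d}
    (hu : u = Pi.single a 1 ∨ u = -Pi.single a 1) :
    Real.cos (SRW.phase p u) = Real.cos (p a) := by
  have h1 : SRW.phase p (Pi.single a 1) = p a := sum_mul_intCast_single_one p a
  rcases hu with rfl | rfl
  · rw [h1]
  · have h2 : SRW.phase p (-Pi.single a 1) = -p a := by
      rw [← h1]; unfold SRW.phase
      simp only [Pi.neg_apply, Int.cast_neg, mul_neg, Finset.sum_neg_distrib]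
    rw [h2, Real.cos_neg]

/-- One coordinate of the dispersion: `1 - cos p_a ≤ ε(p)`. [folklore] -/
theorem one_sub_cos_le_dispersion (p : Fin d → ℝ) (a : Fin d) :
    1 - Real.cos (p a) ≤ dispersion p :=
  Finset.single_le_sum (f := fun j => 1 - Real.cos (p j))
    (fun j _ => sub_nonneg.2 (Real.cos_le_one (p j))) (Finset.mem_univ a)

/-- Two distinct coordinates of the dispersion: `(1 - cos p_a) + (1 - cos p_b) ≤ ε(p)` for `a ≠ b`.
[folklore] -/
theorem one_sub_cos_add_le_dispersion (p : Fin d → ℝ) {a b : Fin d} (hab : a ≠ b) :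
    (1 - Real.cos (p a)) + (1 - Real.cos (p b)) ≤ dispersion p := by
  have h := Finset.sum_le_sum_of_subset_of_nonneg (f := fun j => 1 - Real.cos (p j))
    (Finset.subset_univ ({a, b} : Finset (Fin d)))
    (fun j _ _ => sub_nonneg.2 (Real.cos_le_one (p j)))
  rw [Finset.sum_pair hab] at h
  exact h

/-- **The multiplier bound.** For signed unit coordinate steps `u = ±e_a`, `v = ±e_b` the Fourier
multiplier of `∇_u∇_v G₀` (`G₀ = latticeGreen/2`), `m(p) = (e^{ip·u} - 1)(e^{ip·v} - 1) / (2ε(p))`,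
satisfies `|m(p)|² = (1 - cos p_a)(1 - cos p_b)/ε(p)² ≤ 1`. [folklore] -/
theorem norm_sq_multiplier_le_one (p : Fin d → ℝ) {a b : Fin d} {u v : Site d}
    (hu : u = Pi.single a 1 ∨ u = -Pi.single a 1) (hv : v = Pi.single b 1 ∨ v = -Pi.single b 1) :
    ‖(Complex.exp (Complex.I * (SRW.phase p u : ℝ)) - 1) *
        (Complex.exp (Complex.I * (SRW.phase p v : ℝ)) - 1) / ((2 * dispersion p : ℝ) : ℂ)‖ ^ 2 ≤ 1 := by
  rw [norm_div, norm_mul, div_pow, mul_pow, norm_sq_cexp_I_mul_sub_one, norm_sq_cexp_I_mul_sub_one,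
    cos_phase_unitStep p hu, cos_phase_unitStep p hv, Complex.norm_real, Real.norm_eq_abs,
    abs_of_nonneg (by have := dispersion_nonneg p; positivity)]
  have ha := one_sub_cos_le_dispersion p a
  have hb := one_sub_cos_le_dispersion p b
  have ha0 : 0 ≤ 1 - Real.cos (p a) := sub_nonneg.2 (Real.cos_le_one _)
  have hb0 : 0 ≤ 1 - Real.cos (p b) := sub_nonneg.2 (Real.cos_le_one _)
  rcases eq_or_lt_of_le (dispersion_nonneg p) with h0 | hpos
  · rw [← h0]; norm_num
  · rw [div_le_one (by positivity)]
    nlinarith [mul_le_mul ha hb hb0 (dispersion_nonneg p)]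

/-- **The multiplier bound, mixed directions** (AM–GM): for `a ≠ b`,
`|m(p)|² = (1 - cos p_a)(1 - cos p_b)/ε(p)² ≤ 1/4`, since `(1 - cos p_a) + (1 - cos p_b) ≤ ε(p)`.
[folklore] -/
theorem norm_sq_multiplier_le_quarter (p : Fin d → ℝ) {a b : Fin d} (hab : a ≠ b) {u v : Site d}
    (hu : u = Pi.single a 1 ∨ u = -Pi.single a 1) (hv : v = Pi.single b 1 ∨ v = -Pi.single b 1) :
    ‖(Complex.exp (Complex.I * (SRW.phase p u : ℝ)) - 1) *
        (Complex.exp (Complex.I * (SRW.phase p v : ℝ)) - 1) / ((2 * dispersion p : ℝ) : ℂ)‖ ^ 2 ≤ 1 / 4 := by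
  rw [norm_div, norm_mul, div_pow, mul_pow, norm_sq_cexp_I_mul_sub_one, norm_sq_cexp_I_mul_sub_one,
    cos_phase_unitStep p hu, cos_phase_unitStep p hv, Complex.norm_real, Real.norm_eq_abs,
    abs_of_nonneg (by have := dispersion_nonneg p; positivity)]
  have hab' := one_sub_cos_add_le_dispersion p hab
  have ha0 : 0 ≤ 1 - Real.cos (p a) := sub_nonneg.2 (Real.cos_le_one _)
  have hb0 : 0 ≤ 1 - Real.cos (p b) := sub_nonneg.2 (Real.cos_le_one _)
  rcases eq_or_lt_of_le (dispersion_nonneg p) with h0 | hpos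
  · rw [← h0]; norm_num
  · rw [div_le_iff₀ (by positivity)]
    nlinarith [sq_nonneg (Real.cos (p a) - Real.cos (p b))]


/-! ## §4 A lattice convolution kernel with a Fourier multiplier, tested against a finite family -/

/-- Pointwise identity behind Bessel: for real families `c` on `B` and `ω` on `S`,
`∑_{x∈B} ∑_{y∈S} cₓ ω_y Re (e^{ip·(x-y)} m) = Re (m · (∑ₓ cₓ e^{ip·x}) · conj (∑_y ω_y e^{ip·y}))`.
[folklore] -/
theorem sum_sum_mul_re_eq (B S : Finset (Site d)) (c ω : Site d → ℝ) (p : Fin d → ℝ) (m : ℂ) :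
    ∑ x ∈ B, ∑ y ∈ S, c x * ω y *
        (Complex.exp (Complex.I * (SRW.phase p (x - y) : ℝ)) * m).re =
      (m * (∑ x ∈ B, (c x : ℂ) * Complex.exp (Complex.I * (SRW.phase p x : ℝ))) *
        (starRingEnd ℂ) (∑ y ∈ S, (ω y : ℂ) * Complex.exp (Complex.I * (SRW.phase p y : ℝ)))).re := by
  rw [map_sum, Finset.mul_sum, Complex.re_sum, Finset.sum_comm]
  refine Finset.sum_congr rfl fun y _ => ?_
  rw [Finset.mul_sum, Finset.sum_mul, Complex.re_sum]
  refine Finset.sum_congr rfl fun x _ => ?_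
  rw [map_mul, Complex.conj_ofReal, cexp_phase_sub]
  have h : m * ((c x : ℂ) * Complex.exp (Complex.I * (SRW.phase p x : ℝ))) *
      ((ω y : ℂ) * (starRingEnd ℂ) (Complex.exp (Complex.I * (SRW.phase p y : ℝ)))) =
      ((c x * ω y : ℝ) : ℂ) * (Complex.exp (Complex.I * (SRW.phase p x : ℝ)) *
        (starRingEnd ℂ) (Complex.exp (Complex.I * (SRW.phase p y : ℝ))) * m) := by
    push_cast; ring
  rw [h, Complex.re_ofReal_mul]

/-- **A multiplier kernel tested against a finite family is ONE Brillouin integral.** If a real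
lattice kernel `K` has the Fourier representation `K(w) = (2π)^{-d}∫ Re (e^{ip·w} m(p)) dp` with an
integrable integrand, then for real finite families `c` (on `B`) and `ω` (on `S`):
`∑_{x∈B} cₓ ∑_{y∈S} K(x-y) ω_y = (2π)^{-d} ∫ Re (m · ĉ · conj ω̂) dp`, `ĉ(p) = ∑ₓ cₓ e^{ip·x}`,
`ω̂(p) = ∑_y ω_y e^{ip·y}` (finite sums through the integral). [folklore] -/
theorem sum_mul_conv_eq_integral {K : Site d → ℝ} {m : (Fin d → ℝ) → ℂ}
    (hK : ∀ w, K w = (∫ p in brillouin d,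
      (Complex.exp (Complex.I * (SRW.phase p w : ℝ)) * m p).re) / (2 * Real.pi) ^ d)
    (hm : ∀ w, IntegrableOn (fun p : Fin d → ℝ =>
      (Complex.exp (Complex.I * (SRW.phase p w : ℝ)) * m p).re) (brillouin d))
    (B S : Finset (Site d)) (c ω : Site d → ℝ) :
    ∑ x ∈ B, c x * ∑ y ∈ S, K (x - y) * ω y =
      (∫ p in brillouin d,
        (m p * (∑ x ∈ B, (c x : ℂ) * Complex.exp (Complex.I * (SRW.phase p x : ℝ))) *
          (starRingEnd ℂ) (∑ y ∈ S, (ω y : ℂ) * Complex.exp (Complex.I * (SRW.phase p y : ℝ)))).re) /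
        (2 * Real.pi) ^ d := by
  have hint : ∀ x ∈ B, ∀ y ∈ S, Integrable
      (fun p : Fin d → ℝ => c x * ω y * (Complex.exp (Complex.I * (SRW.phase p (x - y) : ℝ)) * m p).re)
      (volume.restrict (brillouin d)) :=
    fun x _ y _ => (hm (x - y)).const_mul (c x * ω y)
  -- rewrite every kernel value as an integral and pull the finite sums inside
  have hterm : ∀ x ∈ B, c x * ∑ y ∈ S, K (x - y) * ω y =
      (∫ p in brillouin d, ∑ y ∈ S,
        c x * ω y * (Complex.exp (Complex.I * (SRW.phase p (x - y) : ℝ)) * m p).re) /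
        (2 * Real.pi) ^ d := by
    intro x hx
    rw [integral_finsetSum S fun y hy => hint x hx y hy, Finset.mul_sum, Finset.sum_div]
    refine Finset.sum_congr rfl fun y _ => ?_
    rw [hK (x - y), integral_const_mul]
    ring
  rw [Finset.sum_congr rfl hterm, ← Finset.sum_div,
    ← integral_finsetSum B fun x hx => integrable_finsetSum S fun y hy => hint x hx y hy]
  congr 1
  refine setIntegral_congr_fun (measurableSet_brillouin d) fun p _ => ?_
  exact sum_sum_mul_re_eq B S c ω p (m p)

/-! ## §5 Bessel for a multiplier kernel: the `ℓ²` bound on every finite box -/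

/-- Pointwise AM–GM step: `Re (m A conj W) ≤ (|A|² + C|W|²)/2` whenever `|m|² ≤ C`. [folklore] -/
theorem re_mul_mul_conj_le {m A W : ℂ} {C : ℝ} (hm : ‖m‖ ^ 2 ≤ C) :
    (m * A * (starRingEnd ℂ) W).re ≤ (‖A‖ ^ 2 + C * ‖W‖ ^ 2) / 2 := by
  have h1 : (m * A * (starRingEnd ℂ) W).re ≤ ‖m‖ * ‖A‖ * ‖W‖ := by
    calc (m * A * (starRingEnd ℂ) W).re ≤ ‖m * A * (starRingEnd ℂ) W‖ := Complex.re_le_norm _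
      _ = ‖m‖ * ‖A‖ * ‖W‖ := by rw [norm_mul, norm_mul, Complex.norm_conj]
  have h2 : ‖m‖ * ‖A‖ * ‖W‖ ≤ (‖A‖ ^ 2 + ‖m‖ ^ 2 * ‖W‖ ^ 2) / 2 := by
    nlinarith [sq_nonneg (‖A‖ - ‖m‖ * ‖W‖), norm_nonneg m, norm_nonneg A, norm_nonneg W]
  have h3 : ‖m‖ ^ 2 * ‖W‖ ^ 2 ≤ C * ‖W‖ ^ 2 := mul_le_mul_of_nonneg_right hm (sq_nonneg _)
  linarith

/-- ★★ **BESSEL FOR A LATTICE MULTIPLIER KERNEL — abstract form.** If a real kernel `K` on `ℤ^d`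
has the Fourier representation `K(w) = (2π)^{-d}∫_{[-π,π]^d} Re (e^{ip·w} m(p)) dp` with an
integrable integrand and `|m(p)|² ≤ C` on the Brillouin zone, then for every finitely supported
real charge `ω` (carrier `S`) and EVERY finite `B ⊆ ℤ^d`:
`∑_{x∈B} (∑_{y∈S} K(x-y) ω(y))² ≤ C · ∑_{y∈S} ω(y)²`.
Proof: Bessel's inequality for the orthogonal family `{e^{ip·x}}_{x∈B}` against `m · conj ω̂`, in
the AM–GM form `∑c² = (2π)^{-d}∫Re (m ĉ conj ω̂) ≤ ½∑c² + ½C∑ω²` with `c := K ∗ ω` on `B`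
(Parseval §2 for `ĉ` and `ω̂`). [folklore] -/
theorem sum_sq_conv_le_of_multiplier_bound {K : Site d → ℝ} {m : (Fin d → ℝ) → ℂ}
    (hK : ∀ w, K w = (∫ p in brillouin d,
      (Complex.exp (Complex.I * (SRW.phase p w : ℝ)) * m p).re) / (2 * Real.pi) ^ d)
    (hm : ∀ w, IntegrableOn (fun p : Fin d → ℝ =>
      (Complex.exp (Complex.I * (SRW.phase p w : ℝ)) * m p).re) (brillouin d))
    {C : ℝ} (hC : ∀ p ∈ brillouin d, ‖m p‖ ^ 2 ≤ C)
    (S : Finset (Site d)) (ω : Site d → ℝ) (B : Finset (Site d)) :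
    ∑ x ∈ B, (∑ y ∈ S, K (x - y) * ω y) ^ 2 ≤ C * ∑ y ∈ S, ω y ^ 2 := by
  set c : Site d → ℝ := fun x => ∑ y ∈ S, K (x - y) * ω y with hc
  set A : (Fin d → ℝ) → ℂ := fun p =>
    ∑ x ∈ B, (c x : ℂ) * Complex.exp (Complex.I * (SRW.phase p x : ℝ)) with hA
  set W : (Fin d → ℝ) → ℂ := fun p =>
    ∑ y ∈ S, (ω y : ℂ) * Complex.exp (Complex.I * (SRW.phase p y : ℝ)) with hW
  have hπ : (0 : ℝ) < (2 * Real.pi) ^ d := by positivity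
  -- (1) the bilinear identity with the test family `c := K ∗ ω` itself
  have h1 : ∑ x ∈ B, c x ^ 2 =
      (∫ p in brillouin d, (m p * A p * (starRingEnd ℂ) (W p)).re) / (2 * Real.pi) ^ d := by
    rw [show ∑ x ∈ B, c x ^ 2 = ∑ x ∈ B, c x * ∑ y ∈ S, K (x - y) * ω y from
      Finset.sum_congr rfl fun x _ => by rw [sq]]
    exact sum_mul_conv_eq_integral hK hm B S c ω
  -- (2) integrability of both sides of the pointwise AM–GM bound
  have hintR : IntegrableOn (fun p => (‖A p‖ ^ 2 + C * ‖W p‖ ^ 2) / 2) (brillouin d) := by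
    have hcR : Continuous fun p => (‖A p‖ ^ 2 + C * ‖W p‖ ^ 2) / 2 := by
      simp only [hA, hW]; unfold SRW.phase; fun_prop
    exact hcR.continuousOn.integrableOn_compact (isCompact_brillouin d)
  have hintL : IntegrableOn (fun p => (m p * A p * (starRingEnd ℂ) (W p)).re) (brillouin d) := by
    have hfun : (fun p => (m p * A p * (starRingEnd ℂ) (W p)).re) = fun p =>
        ∑ x ∈ B, ∑ y ∈ S, c x * ω y *
          (Complex.exp (Complex.I * (SRW.phase p (x - y) : ℝ)) * m p).re :=
      funext fun p => (sum_sum_mul_re_eq B S c ω p (m p)).symm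
    rw [hfun]
    exact integrable_finsetSum B fun x _ => integrable_finsetSum S fun y _ =>
      (hm (x - y)).const_mul (c x * ω y)
  -- (3) integrate the pointwise bound; (4) Parseval for `A` and `W`
  have h3 : ∫ p in brillouin d, (m p * A p * (starRingEnd ℂ) (W p)).re ≤
      ∫ p in brillouin d, (‖A p‖ ^ 2 + C * ‖W p‖ ^ 2) / 2 :=
    setIntegral_mono_on hintL hintR (measurableSet_brillouin d) fun p hp =>
      re_mul_mul_conj_le (hC p hp)
  have hintA2 : IntegrableOn (fun p => ‖A p‖ ^ 2) (brillouin d) :=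
    (by simp only [hA]; unfold SRW.phase; fun_prop : Continuous fun p => ‖A p‖ ^ 2)
      |>.continuousOn.integrableOn_compact (isCompact_brillouin d)
  have hintW2 : IntegrableOn (fun p => ‖W p‖ ^ 2) (brillouin d) :=
    (by simp only [hW]; unfold SRW.phase; fun_prop : Continuous fun p => ‖W p‖ ^ 2)
      |>.continuousOn.integrableOn_compact (isCompact_brillouin d)
  have h4 : ∫ p in brillouin d, (‖A p‖ ^ 2 + C * ‖W p‖ ^ 2) / 2 =
      ((2 * Real.pi) ^ d * ∑ x ∈ B, c x ^ 2 + C * ((2 * Real.pi) ^ d * ∑ y ∈ S, ω y ^ 2)) / 2 := by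
    rw [integral_div, integral_add hintA2 (hintW2.const_mul C), integral_const_mul,
      integral_norm_sq_trigPoly B c, integral_norm_sq_trigPoly S ω]
  -- (5) conclude: `∑c² ≤ ½∑c² + ½C∑ω²`
  have h5 : ∑ x ∈ B, c x ^ 2 ≤ (∑ x ∈ B, c x ^ 2 + C * ∑ y ∈ S, ω y ^ 2) / 2 :=
    calc ∑ x ∈ B, c x ^ 2
        = (∫ p in brillouin d, (m p * A p * (starRingEnd ℂ) (W p)).re) / (2 * Real.pi) ^ d := h1
      _ ≤ (∫ p in brillouin d, (‖A p‖ ^ 2 + C * ‖W p‖ ^ 2) / 2) / (2 * Real.pi) ^ d :=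
          div_le_div_of_nonneg_right h3 hπ.le
      _ = (∑ x ∈ B, c x ^ 2 + C * ∑ y ∈ S, ω y ^ 2) / 2 := by
          rw [h4]; field_simp
  linarith

end Summit.QuantumFields.YangMills.Theorems.CovariantDischargeBrillouinMultiplierBessel

end
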